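import Literature.Probability.Percolation.TileDataOfZones
import Literature.Probability.Percolation.PortChainFamily
import HarnessLib

/-!
# The family of tile domains of the gluing zones (disconnected tube)

Topic `Probability/Percolation`.  Support file (definitions and proofs, no named fact) for step (C)
of the proof of Schramm–Smirnov's Prop. 4.1 (Ann. Probab. 39 (2011), §4).  `TileDataOfZones.lean`
builds ONE tile domain from the gluing zones under `Zones.Nice`, whose clause `N_conn` (the tube is
connected) fails in general: the cut `α ∩ [Q₀]` falls into finitely many pieces once the junction
squares are excised, and the corridors that open the enclosed far components cut the tube further
(both are forced, cf. the printed proof: `M'` is "the component of `[Q₀] ∖ β'` containing `α`"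
only loosely).  Here the accessible fresh edges are split into their **accessibility classes**
(chains of accessible fresh edges through non-hub sites) and one `TileData` is built per class
(`Zones.tileDataCls`), all sharing the hub vertices, the examined edges, the wet faces and the
window; they form a `TileFamily` (`Zones.tileFamily`, `PortChainFamily.lean`), to which the
multi-loop structure theorem `TileFamily.mem_z2QuadConfig_iff_portChain` applies.

The niceness hypothesis is weakened to `Zones.Nice'`: tube sites have no far neighbours, the outside
of the window is walkable to infinity, and every tube component reaches a tube site next to a site
outside the window (an excised square) — the last clause replaces connectedness in the escape of
the cells of the OTHER classes (`esc_P`): they are pockets for the class at hand and run along their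
own tube to a square.

Everything is proved; no named fact is introduced.

## References

* O. Schramm, S. Smirnov, Ann. Probab. 39 (2011), arXiv:1101.5820, §4, proof of Prop. 4.1 (the
  sets `M`, `M'` and the graph `G*`). [SchrammSmirnov2011]
-/

noncomputable section

open Set Relation
open Literature.Probability.LatticeModels
open scoped Classical

namespace Literature.Probability.Percolation

namespace Seeded

namespace Zones

variable (𝒵 : Zones) {X : Finset (Sym2 (Site 2))} {ω : BondConfig (Site 2)}

open CellComplex

/-- **Geometric niceness of the zones, disconnected form**: tube sites have all four neighbours in
`K ∪ N ∪ SQ`; from every site outside the window one can walk off to infinity outside the window;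
and from every tube site one can walk along the tube to a tube site with a neighbour outside the
window. [cite: SchrammSmirnov2011, §4, proof of Prop. 4.1 (setup)] -/
structure Nice' : Prop where
  /-- tube sites have no far neighbours -/
  N_nbr : ∀ v ∈ 𝒵.N, ∀ k : Fin 4, v + cornerUnit k ∈ 𝒵.K ∨ v + cornerUnit k ∈ 𝒵.N ∨ v + cornerUnit k ∈ 𝒵.SQ
  /-- the outside of the window is walkable to infinity -/
  W_esc : ∀ u, u ∉ 𝒵.K → u ∉ 𝒵.N → ∀ R : ℝ, ∃ u', R < ‖Site.toComplex u'‖ ∧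
    ReflTransGen (fun a b => (a ∉ 𝒵.K ∧ a ∉ 𝒵.N) ∧ (b ∉ 𝒵.K ∧ b ∉ 𝒵.N) ∧ ∃ k : Fin 4, b = a + cornerUnit k) u u'
  /-- every tube component reaches a tube site next to the outside of the window -/
  N_touch : ∀ n ∈ 𝒵.N, ∃ n', ReflTransGen (fun a b => a ∈ 𝒵.N ∧ b ∈ 𝒵.N ∧ ∃ k : Fin 4, b = a + cornerUnit k) n n' ∧
    ∃ k : Fin 4, n' + cornerUnit k ∉ 𝒵.Wv

variable {𝒵}

/-- **Fresh edges join window sites** (as `fresh_endpoints`, from `Nice'`). [folklore] -/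
theorem fresh_endpoints' (hT : IsTerminal 𝒵.seeds X ω) (hN : 𝒵.Nice') {e : Sym2 (Site 2)}
    (he : e ∈ 𝒵.fresh X) : ∀ v ∈ e, v ∈ 𝒵.Wv := by
  intro v hv
  rcases 𝒵.mem_fresh_iff.1 he with ⟨heA, heX⟩ | het
  · obtain ⟨heE, -, hall⟩ := 𝒵.collar.mem_A_iff.1 heA
    rcases hall v hv with hK | hF
    · exact Or.inl hK
    · exfalso
      refine hT.not_eligible e ⟨heA, heX, ⟨v, hv, oReach_of_mem_seeds X ω hF⟩, ?_⟩
      obtain ⟨a, b, -, hab⟩ := exists_dualEdge_eq_mk heE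
      refine ⟨a, isFaceOf_left_of_dualEdge_eq hab, dReach_of_mem_seeds X ω ?_⟩
      exact ⟨v, touchesFace_of_isFaceOf heE (isFaceOf_left_of_dualEdge_eq hab) hv, hF⟩
  · obtain ⟨heE, ⟨u, hue, huN⟩, hSQ⟩ := 𝒵.mem_tubeEdges_iff.1 het
    by_cases huv : v = u
    · exact Or.inr (huv ▸ huN)
    · obtain ⟨k, hk⟩ := exists_eq_dartEdge_of_mem heE hue
      have hvk : v = u + cornerUnit k := by
        have : v ∈ dartEdge u k := hk ▸ hv
        rcases mem_dartEdge_iff.1 this with h | h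
        · exact absurd h huv
        · exact h
      rcases hN.N_nbr u huN k with h | h | h
      · exact Or.inl (hvk ▸ h)
      · exact Or.inr (hvk ▸ h)
      · exact absurd (hvk ▸ h) (hSQ v hv)

/-! ### Accessibility classes -/

section Cls

variable (𝒵) (X ω)

/-- **Links between accessible fresh edges**: both accessible, sharing a non-hub site. [folklore] -/
def Lnk (a b : Sym2 (Site 2)) : Prop :=
  𝒵.Acc X ω a ∧ 𝒵.Acc X ω b ∧ ∃ w, w ∈ a ∧ w ∈ b ∧ ¬ OReach 𝒵.seeds X ω w

/-- **The accessibility class** of the edge `e₀`: the fresh edges linked to it.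
[cite: SchrammSmirnov2011, §4, proof of Prop. 4.1 (the pieces of M')] -/
def accCls (e₀ : Sym2 (Site 2)) : Finset (Sym2 (Site 2)) :=
  (𝒵.fresh X).filter fun e => ReflTransGen (𝒵.Lnk X ω) e₀ e

variable {𝒵 X ω}

/-- `Lnk` is symmetric. [folklore] -/
theorem Lnk.symm {a b : Sym2 (Site 2)} (h : 𝒵.Lnk X ω a b) : 𝒵.Lnk X ω b a := by
  obtain ⟨ha, hb, w, hwa, hwb, hwO⟩ := h; exact ⟨hb, ha, w, hwb, hwa, hwO⟩

/-- Chains of links reverse. [folklore] -/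
theorem reflTransGen_lnk_symm {a b : Sym2 (Site 2)} (h : ReflTransGen (𝒵.Lnk X ω) a b) :
    ReflTransGen (𝒵.Lnk X ω) b a := by
  induction h with
  | refl => exact ReflTransGen.refl
  | tail _ hst ih => exact ReflTransGen.head hst.symm ih

/-- Membership in a class. [folklore] -/
theorem mem_accCls_iff {e₀ e : Sym2 (Site 2)} : e ∈ 𝒵.accCls X ω e₀ ↔ e ∈ 𝒵.fresh X ∧ ReflTransGen (𝒵.Lnk X ω) e₀ e := by
  rw [accCls, Finset.mem_filter]

/-- Edges linked to an accessible edge are accessible. [folklore] -/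
theorem acc_of_reflTransGen_lnk {e₀ e : Sym2 (Site 2)} (he₀ : 𝒵.Acc X ω e₀) (h : ReflTransGen (𝒵.Lnk X ω) e₀ e) :
    𝒵.Acc X ω e := by
  induction h with
  | refl => exact he₀
  | tail _ hst _ => exact hst.2.1

/-- Members of the class of an accessible edge are accessible. [folklore] -/
theorem acc_of_mem_accCls {e₀ e : Sym2 (Site 2)} (he₀ : 𝒵.Acc X ω e₀) (he : e ∈ 𝒵.accCls X ω e₀) : 𝒵.Acc X ω e :=
  acc_of_reflTransGen_lnk he₀ (mem_accCls_iff.1 he).2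

/-- An accessible edge is in its own class. [folklore] -/
theorem mem_accCls_self {e₀ : Sym2 (Site 2)} (he₀ : 𝒵.Acc X ω e₀) : e₀ ∈ 𝒵.accCls X ω e₀ :=
  mem_accCls_iff.2 ⟨he₀.mem_fresh, ReflTransGen.refl⟩

/-- **Classes are closed under fresh edges through non-hub sites.** [folklore] -/
theorem mem_accCls_step {e₀ e e' : Sym2 (Site 2)} (he₀ : 𝒵.Acc X ω e₀) (he : e ∈ 𝒵.accCls X ω e₀)
    (he' : e' ∈ 𝒵.fresh X) {w : Site 2} (hw : w ∈ e) (hw' : w ∈ e') (hwO : ¬ OReach 𝒵.seeds X ω w) :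
    e' ∈ 𝒵.accCls X ω e₀ := by
  obtain ⟨-, hch⟩ := mem_accCls_iff.1 he
  have hacc : 𝒵.Acc X ω e := acc_of_reflTransGen_lnk he₀ hch
  exact mem_accCls_iff.2 ⟨he', hch.tail ⟨hacc, hacc.step he' hw hw' hwO, w, hw, hw', hwO⟩⟩

/-- **Two classes meeting at a non-hub site coincide** (as sets of members). [folklore] -/
theorem mem_accCls_of_mem_accCls {e₀ e₁ e a : Sym2 (Site 2)}
    (he : e ∈ 𝒵.accCls X ω e₀) (he' : e ∈ 𝒵.accCls X ω e₁) (ha : a ∈ 𝒵.accCls X ω e₁) : a ∈ 𝒵.accCls X ω e₀ := by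
  obtain ⟨-, h0e⟩ := mem_accCls_iff.1 he
  obtain ⟨-, h1e⟩ := mem_accCls_iff.1 he'
  obtain ⟨haf, h1a⟩ := mem_accCls_iff.1 ha
  exact mem_accCls_iff.2 ⟨haf, (h0e.trans (reflTransGen_lnk_symm h1e)).trans h1a⟩

end Cls

/-! ### The tile data of one class -/

/-- **The tile data of one accessibility class at terminality.**  The hub vertices, examined edges,
wet faces and window are those of `Zones.tileData`; the accessible edges are the class of the tube
edge `e₀`. [cite: SchrammSmirnov2011, §4, proof of Prop. 4.1 (one piece of M')] -/
def tileDataCls (hT : IsTerminal 𝒵.seeds X ω) (hN : 𝒵.Nice') {e₀ : Sym2 (Site 2)} (he₀ : e₀ ∈ 𝒵.tubeEdges) : TileData where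
  O := {v | OReach 𝒵.seeds X ω v}
  hubE := {e | e ∈ X ∧ e ∈ ω}
  clE := {e | e ∈ X ∧ e ∉ ω}
  Dset := {f | DReach 𝒵.seeds X ω f}
  acc := 𝒵.accCls X ω e₀
  Wv := 𝒵.Wv
  acc_edge e he := 𝒵.mem_edgeSet_of_mem_fresh (mem_accCls_iff.1 he).1
  acc_window e he := fresh_endpoints' hT hN (mem_accCls_iff.1 he).1
  acc_not_hub e he h := 𝒵.not_mem_of_mem_fresh hT.subset (mem_accCls_iff.1 he).1 h.1
  acc_not_cl e he h := 𝒵.not_mem_of_mem_fresh hT.subset (mem_accCls_iff.1 he).1 h.1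
  hub_edge e he := 𝒵.seeds.A_subset e (hT.subset he.1)
  hub_O e he v hv := hT.oReach_of_mem he.1 he.2 hv
  cl_O e he := (hT.two_arms e he.1).1
  cl_D e he f hf := hT.dReach_of_mem he.1 he.2 hf
  closure e he w hwe hwO e' he'E hwe' hwin := by
    by_cases he'X : e' ∈ X
    · by_cases he'ω : e' ∈ ω
      · exact Or.inl ⟨he'X, he'ω⟩
      · exact Or.inr (Or.inl ⟨he'X, he'ω⟩)
    · right; right
      exact mem_accCls_step (acc_of_mem_tubeEdges he₀) he (𝒵.fresh_of_window he'E hwin he'X) hwe hwe' hwO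
  T3 f hf w hwO e₁ he₁ e₂ he₂ hne hw₁ hw₂ hf₁ hf₂ := by
    have hne1 : ∀ j : Fin 4, j + 1 ≠ j := by decide
    have hne3 : ∀ j : Fin 4, j + 3 ≠ j := by decide
    obtain ⟨he₁f, -⟩ := mem_accCls_iff.1 he₁
    obtain ⟨he₂f, -⟩ := mem_accCls_iff.1 he₂
    have key : ∀ e, e ∈ 𝒵.fresh X → w ∈ e → IsFaceOf f e → e ∈ 𝒵.tubeEdges := by
      intro e hef hwe hfe
      rcases 𝒵.mem_fresh_iff.1 hef with ⟨heA, heX⟩ | het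
      · exact absurd hf (hT.not_dReach_of_not_mem heA heX hwe hwO hfe)
      · exact het
    have ht₁ := key e₁ he₁f hw₁ hf₁
    have ht₂ := key e₂ he₂f hw₂ hf₂
    have hwK : w ∈ 𝒵.K := by
      rcases 𝒵.mem_K_or_Far_of_oReach hT hwO with h | h
      · exact h
      · exact absurd (fresh_endpoints' hT hN he₁f w hw₁) (𝒵.not_mem_Wv_of_mem_Far h)
    have hwf : TouchesFace w f := touchesFace_of_isFaceOf (𝒵.mem_edgeSet_of_mem_fresh he₁f) hf₁ hw₁
    obtain ⟨j, hj⟩ := touchesFace_iff_exists_cornerOff.1 hwf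
    have he₁E := 𝒵.mem_edgeSet_of_mem_fresh he₁f
    have he₂E := 𝒵.mem_edgeSet_of_mem_fresh he₂f
    have hs₁ := faceSide_of_mem_corner he₁E hf₁ (hj ▸ hw₁)
    have hs₂ := faceSide_of_mem_corner he₂E hf₂ (hj ▸ hw₂)
    have hsides : ∀ e, (e = faceSide f j ∨ e = faceSide f (j + 3)) → e ∈ 𝒵.tubeEdges := by
      rintro e (rfl | rfl)
      · rcases hs₁ with h | h
        · exact h ▸ ht₁
        · rcases hs₂ with h' | h'
          · exact h' ▸ ht₂
          · exact absurd (h.trans h'.symm) hne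
      · rcases hs₁ with h | h
        · rcases hs₂ with h' | h'
          · exact absurd (h.trans h'.symm) hne
          · exact h' ▸ ht₂
        · exact h ▸ ht₁
    have hwN : w ∉ 𝒵.N := fun h => Finset.disjoint_left.1 𝒵.disjoint_K_N hwK h
    have hN_of_side : ∀ e ∈ 𝒵.tubeEdges, w ∈ e → ∀ v ∈ e, v ≠ w → v ∈ 𝒵.N := by
      intro e het hwe v hve hvw
      obtain ⟨-, ⟨u, hue, huN⟩, -⟩ := 𝒵.mem_tubeEdges_iff.1 het
      by_cases huw : u = w
      · exact absurd (huw ▸ huN) hwN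
      · have he : e = s(u, w) := (Sym2.mem_and_mem_iff huw).1 ⟨hue, hwe⟩
        rw [he, Sym2.mem_iff] at hve
        rcases hve with rfl | rfl
        · exact huN
        · exact absurd rfl hvw
    have hc1 : f + cornerOff (j + 1) ∈ 𝒵.N := by
      refine hN_of_side _ (hsides _ (Or.inl rfl)) (mem_faceSide_iff.2 (Or.inl hj)) _
        (mem_faceSide_iff.2 (Or.inr rfl)) fun h => ?_
      exact hne1 j (cornerOff_add_inj f (h.trans hj))
    have hc3 : f + cornerOff (j + 3) ∈ 𝒵.N := by
      refine hN_of_side _ (hsides _ (Or.inr rfl)) (mem_faceSide_iff.2 (Or.inr (by rw [fin4_add_three_add_one]; exact hj))) _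
        (mem_faceSide_iff.2 (Or.inl rfl)) fun h => ?_
      exact hne3 j (cornerOff_add_inj f (h.trans hj))
    have hc2 : f + cornerOff (j + 2) ∈ 𝒵.K ∨ f + cornerOff (j + 2) ∈ 𝒵.N ∨ f + cornerOff (j + 2) ∈ 𝒵.SQ := by
      have : f + cornerOff (j + 2) = f + cornerOff (j + 1) + cornerUnit (j + 1) := by
        rw [cornerUnit_eq_off_sub, fin4_add_one_add_one]; abel
      rw [this]
      exact hN.N_nbr _ hc1 (j + 1)
    rcases exists_mem_of_dReach hf with hD₀ | ⟨c, hcX, hcω, hfc⟩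
    · obtain ⟨s, hsf, hsFar⟩ := hD₀
      obtain ⟨m, rfl⟩ := touchesFace_iff_exists_cornerOff.1 hsf
      obtain ⟨i, rfl⟩ := fin4_exists_add j m
      fin_cases i
      · simp only [Fin.zero_eta, add_zero] at hsFar
        exact hsFar.1 (hj ▸ hwK)
      · simp only [Fin.mk_one] at hsFar
        exact hsFar.2.1 hc1
      · simp only [Fin.reduceFinMk] at hsFar
        rcases hc2 with h | h | h
        · exact hsFar.1 h
        · exact hsFar.2.1 h
        · exact hsFar.2.2 h
      · simp only [Fin.reduceFinMk] at hsFar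
        exact hsFar.2.1 hc3
    · have hcA := hT.subset hcX
      have hcE := 𝒵.seeds.A_subset c hcA
      obtain ⟨m, rfl⟩ := (isFaceOf_iff_exists_faceSide hcE).1 hfc
      obtain ⟨i, rfl⟩ := fin4_exists_add j m
      have hKF : ∀ v ∈ faceSide f (j + i), v ∈ 𝒵.K ∨ v ∈ 𝒵.Far := (𝒵.collar.mem_A_iff.1 hcA).2.2
      have hnotN : ∀ v ∈ faceSide f (j + i), v ∉ 𝒵.N := fun v hv hvN => by
        rcases hKF v hv with h | h
        · exact Finset.disjoint_left.1 𝒵.disjoint_K_N h hvN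
        · exact h.2.1 hvN
      have hfreshX : ∀ e ∈ 𝒵.tubeEdges, e ∉ X := fun e het heX =>
        𝒵.not_mem_A_of_mem_tubeEdges het (hT.subset heX)
      fin_cases i
      · exact hfreshX _ (hsides _ (Or.inl (by simp))) hcX
      · exact hnotN _ (mem_faceSide_iff.2 (Or.inl rfl)) (by simpa using hc1)
      · refine hnotN _ (mem_faceSide_iff.2 (Or.inr ?_)) hc3
        simp only [Fin.reduceFinMk]; rw [LatticeModels.fin4_add_two_add_one]
      · exact hfreshX _ (hsides _ (Or.inr (by simp))) hcX
  acc_nonO e he := by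
    obtain ⟨-, h⟩ := mem_accCls_iff.1 he
    cases h with
    | refl =>
      obtain ⟨-, ⟨n, hn, hnN⟩, -⟩ := 𝒵.mem_tubeEdges_iff.1 he₀
      exact ⟨n, hn, 𝒵.not_oReach_of_mem_N hT hnN⟩
    | tail _ hst =>
      obtain ⟨-, -, v, -, hv, hvO⟩ := hst
      exact ⟨v, hv, hvO⟩
  acc_conn e he e' he' := by
    set S : Sym2 (Site 2) → Sym2 (Site 2) → Prop := fun a b =>
      a ∈ 𝒵.accCls X ω e₀ ∧ b ∈ 𝒵.accCls X ω e₀ ∧ ∃ w, w ∈ a ∧ w ∈ b ∧ w ∉ {v | OReach 𝒵.seeds X ω v} with hS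
    have hacc₀ : 𝒵.Acc X ω e₀ := acc_of_mem_tubeEdges he₀
    -- a chain of links from `e₀` is a chain of `S` (all its edges are in the class)
    have fromRep : ∀ {a}, ReflTransGen (𝒵.Lnk X ω) e₀ a → ReflTransGen S e₀ a := by
      intro a h
      induction h with
      | refl => exact ReflTransGen.refl
      | tail hab hst ih =>
        rename_i b c
        obtain ⟨hb, hc, w, hwb, hwc, hwO⟩ := hst
        exact ih.tail ⟨mem_accCls_iff.2 ⟨hb.mem_fresh, hab⟩, mem_accCls_iff.2 ⟨hc.mem_fresh, hab.tail ⟨hb, hc, w, hwb, hwc, hwO⟩⟩,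
          w, hwb, hwc, hwO⟩
    have Ssymm : ∀ {a b}, S a b → S b a := fun ⟨ha, hb, w, hwa, hwb, hwO⟩ => ⟨hb, ha, w, hwb, hwa, hwO⟩
    have RTsymm : ∀ {a b}, ReflTransGen S a b → ReflTransGen S b a := by
      intro a b h
      induction h with
      | refl => exact ReflTransGen.refl
      | tail _ hst ih => exact ReflTransGen.head (Ssymm hst) ih
    exact (RTsymm (fromRep (mem_accCls_iff.1 he).2)).trans (fromRep (mem_accCls_iff.1 he').2)
  esc_W u hu R := by
    have hu' : u ∉ 𝒵.K ∧ u ∉ 𝒵.N := ⟨fun h => hu (Or.inl h), fun h => hu (Or.inr h)⟩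
    obtain ⟨u', hfar, hwalk⟩ := hN.W_esc u hu'.1 hu'.2 R
    refine ⟨u', hfar, ?_⟩
    clear hfar
    induction hwalk with
    | refl => exact ReflTransGen.refl
    | tail _ hst ih =>
      obtain ⟨ha, hb, hk⟩ := hst
      exact ih.tail ⟨fun h => h.elim ha.1 ha.2, fun h => h.elim hb.1 hb.2, hk⟩
  esc_O v hv := by
    obtain ⟨s, hs, hchain⟩ := hv
    refine ⟨s, 𝒵.not_mem_Wv_of_mem_Far hs, ?_⟩
    clear hs
    induction hchain with
    | refl => exact ReflTransGen.refl
    | tail _ hst ih => exact ReflTransGen.head (by rw [Sym2.eq_swap]; exact ⟨hst.1, hst.2⟩) ih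
  esc_D f hf := by
    obtain ⟨g, hg, hchain⟩ := hf
    refine ⟨g, ?_, ?_⟩
    · obtain ⟨u, hug, huF⟩ := hg
      exact ⟨u, 𝒵.not_mem_Wv_of_mem_Far huF, hug⟩
    · have key : ∀ b, ReflTransGen (fun a b => ∃ e ∈ X, e ∉ ω ∧ e ∈ (zdGraph 2).edgeSet ∧ dualEdge e = s(a, b)) g b →
          ReflTransGen (fun a b => b ∈ {f | DReach 𝒵.seeds X ω f} ∧ ∃ c ∈ {e : Sym2 (Site 2) | e ∈ X ∧ e ∉ ω},
            c ∈ (zdGraph 2).edgeSet ∧ IsFaceOf a c ∧ IsFaceOf b c) b g := by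
        intro b hb
        induction hb with
        | refl => exact ReflTransGen.refl
        | tail hab hst ih =>
          rename_i a' b'
          obtain ⟨e, heX, heω, heE, hd⟩ := hst
          have ha'D : DReach 𝒵.seeds X ω a' := ⟨g, hg, hab⟩
          exact ReflTransGen.head ⟨ha'D, e, ⟨heX, heω⟩, heE, isFaceOf_right_of_dualEdge_eq hd,
            isFaceOf_left_of_dualEdge_eq hd⟩ ih
      exact key f hchain
  esc_P e heE hwin hh hcl hacc := by
    have heX : e ∉ X := fun h => by
      by_cases hω : e ∈ ω
      · exact hh ⟨h, hω⟩
      · exact hcl ⟨h, hω⟩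
    have hacc₀ : 𝒵.Acc X ω e₀ := acc_of_mem_tubeEdges he₀
    -- the target relation is monotone: it only asks edges to be outside the class
    set R : Sym2 (Site 2) → Sym2 (Site 2) → Prop := fun a b => b ∈ (zdGraph 2).edgeSet ∧ (∀ v ∈ b, v ∈ 𝒵.Wv) ∧
      ¬ (b ∈ X ∧ b ∈ ω) ∧ ¬ (b ∈ X ∧ b ∉ ω) ∧ b ∉ 𝒵.accCls X ω e₀ ∧ ∃ u, u ∈ a ∧ u ∈ b with hR
    by_cases hA : 𝒵.Acc X ω e
    · -- an accessible edge of ANOTHER class: walk back to its tube edge, then along the tube to a square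
      obtain ⟨e₁, he₁, hch⟩ := hA
      -- every edge of the chain from `e₁` to `e` is accessible and outside the class of `e₀`
      -- (else `e` would be in the class); record the chain backwards in `R`
      have notCls : ∀ {a b}, ReflTransGen (𝒵.AccStep X ω) a b → b ∉ 𝒵.accCls X ω e₀ → 𝒵.Acc X ω a →
          a ∉ 𝒵.accCls X ω e₀ := by
        intro a b h hb ha haCls
        apply hb
        clear hb
        induction h with
        | refl => exact haCls
        | tail hab hst ih =>
          obtain ⟨hcf, v, hvb, hvc, hvO⟩ := hst
          exact mem_accCls_step hacc₀ ih hcf hvb hvc hvO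
      have heCls : e ∉ 𝒵.accCls X ω e₀ := hacc
      have back : ∀ {b}, ReflTransGen (𝒵.AccStep X ω) e₁ b → b ∉ 𝒵.accCls X ω e₀ → ReflTransGen R b e₁ := by
        intro b h hb
        induction h with
        | refl => exact ReflTransGen.refl
        | tail hab hst ih =>
          rename_i b' c
          obtain ⟨hcf, v, hvb, hvc, hvO⟩ := hst
          have hb'acc : 𝒵.Acc X ω b' := ⟨e₁, he₁, hab⟩
          have hb'Cls : b' ∉ 𝒵.accCls X ω e₀ := fun h => hb (mem_accCls_step hacc₀ h hcf hvb hvc hvO)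
          have hb'f : b' ∈ 𝒵.fresh X := hb'acc.mem_fresh
          have hb'E := 𝒵.mem_edgeSet_of_mem_fresh hb'f
          have hb'X : b' ∉ X := 𝒵.not_mem_of_mem_fresh hT.subset hb'f
          refine ReflTransGen.head ⟨hb'E, fresh_endpoints' hT hN hb'f, fun h => hb'X h.1, fun h => hb'X h.1, hb'Cls,
            v, hvc, hvb⟩ (ih hb'Cls)
      have h1 : ReflTransGen R e e₁ := back hch heCls
      -- `e₁` is a tube edge outside the class; walk along its tube component to a square
      have he₁Cls : e₁ ∉ 𝒵.accCls X ω e₀ := notCls hch heCls (acc_of_mem_tubeEdges he₁)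
      obtain ⟨-, ⟨n₁, hn₁e, hn₁N⟩, -⟩ := 𝒵.mem_tubeEdges_iff.1 he₁
      obtain ⟨n', hwalk, k, hk⟩ := hN.N_touch n₁ hn₁N
      -- tube darts along the walk are accessible tube edges outside the class
      have tubeAcc : ∀ n ∈ 𝒵.N, ∀ k : Fin 4, n + cornerUnit k ∈ 𝒵.N → dartEdge n k ∈ 𝒵.tubeEdges := by
        intro n hn k hnk
        refine 𝒵.mem_tubeEdges_iff.2 ⟨dartEdge_mem_edgeSet n k, ⟨n, mem_dartEdge_iff.2 (Or.inl rfl), hn⟩, fun v hv => ?_⟩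
        rcases mem_dartEdge_iff.1 hv with rfl | rfl
        · exact fun h => Finset.disjoint_left.1 𝒵.disjoint_N_SQ hn h
        · exact fun h => Finset.disjoint_left.1 𝒵.disjoint_N_SQ hnk h
      -- invariant: current tube site `m` lies on an edge `a` outside the class reached by `R` from `e`
      have along : ∀ m, ReflTransGen (fun a b => a ∈ 𝒵.N ∧ b ∈ 𝒵.N ∧ ∃ k : Fin 4, b = a + cornerUnit k) n₁ m →
          ∃ a, a ∈ 𝒵.tubeEdges ∧ a ∉ 𝒵.accCls X ω e₀ ∧ m ∈ a ∧ ReflTransGen R e a := by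
        intro m hm
        induction hm with
        | refl => exact ⟨e₁, he₁, he₁Cls, hn₁e, h1⟩
        | @tail m m' _ hst ih =>
          obtain ⟨hmN, hm'N, k', rfl⟩ := hst
          obtain ⟨a, ha, haCls, hma, hRa⟩ := ih
          have hd : dartEdge m k' ∈ 𝒵.tubeEdges := tubeAcc m hmN k' hm'N
          have hdacc : 𝒵.Acc X ω (dartEdge m k') := acc_of_mem_tubeEdges hd
          have hmO : ¬ OReach 𝒵.seeds X ω m := 𝒵.not_oReach_of_mem_N hT hmN
          -- the dart is linked to `a` through the non-hub tube site `m`: same class status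
          have haf : a ∈ 𝒵.fresh X := (acc_of_mem_tubeEdges (X := X) (ω := ω) ha).mem_fresh
          have hdCls : dartEdge m k' ∉ 𝒵.accCls X ω e₀ := fun h =>
            haCls (mem_accCls_step hacc₀ h haf (mem_dartEdge_iff.2 (Or.inl rfl)) hma hmO)
          have hdf : dartEdge m k' ∈ 𝒵.fresh X := hdacc.mem_fresh
          have hdX : dartEdge m k' ∉ X := 𝒵.not_mem_of_mem_fresh hT.subset hdf
          refine ⟨dartEdge m k', hd, hdCls, mem_dartEdge_iff.2 (Or.inr rfl), hRa.tail ⟨dartEdge_mem_edgeSet _ _,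
            fresh_endpoints' hT hN hdf, fun h => hdX h.1, fun h => hdX h.1, hdCls, m, hma, mem_dartEdge_iff.2 (Or.inl rfl)⟩⟩
      obtain ⟨a, -, -, hn'a, hRa⟩ := along n' hwalk
      exact ⟨a, n', hn'a, Or.inr (Or.inr ⟨k, hk⟩), hRa⟩
    · -- a genuine pocket: the escape of `TileDataOfZones`, with the class in place of all accessible edges
      obtain ⟨e', u, hue', hend, hchain⟩ := 𝒵.exists_pocket_escape hT heE hwin heX hA
      refine ⟨e', u, hue', hend, ?_⟩
      refine reflTransGen_of_imp (fun a b hab => ?_) hchain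
      obtain ⟨hbE, hbwin, hbo, hbc, hbacc, hu⟩ := hab
      refine ⟨hbE, hbwin, hbo, hbc, fun hb => hbacc ?_, hu⟩
      have hbA : 𝒵.Acc X ω b := acc_of_mem_accCls hacc₀ hb
      exact Finset.mem_filter.2 ⟨hbA.mem_fresh, hbA⟩

/-! ### The family -/

/-- **The family of tile domains of the zones**, indexed by the tube edges (one class each; classes
may repeat). [cite: SchrammSmirnov2011, §4, proof of Prop. 4.1 (M')] -/
def tileFamily (hT : IsTerminal 𝒵.seeds X ω) (hN : 𝒵.Nice') : TileFamily {e // e ∈ 𝒵.tubeEdges} where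
  𝒯 i := 𝒵.tileDataCls hT hN i.2
  O := {v | OReach 𝒵.seeds X ω v}
  hubE := {e | e ∈ X ∧ e ∈ ω}
  clE := {e | e ∈ X ∧ e ∉ ω}
  Wv := 𝒵.Wv
  O_eq _ := rfl
  hubE_eq _ := rfl
  clE_eq _ := rfl
  Wv_eq _ := rfl

/-- **The accessible edges of the family are all the accessible fresh edges.** [folklore] -/
theorem mem_accU_tileFamily_iff (hT : IsTerminal 𝒵.seeds X ω) (hN : 𝒵.Nice') {e : Sym2 (Site 2)} :
    e ∈ (𝒵.tileFamily hT hN).accU ↔ 𝒵.Acc X ω e := by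
  rw [TileFamily.mem_accU_iff]
  constructor
  · rintro ⟨i, hi⟩
    exact acc_of_mem_accCls (acc_of_mem_tubeEdges i.2) hi
  · rintro ⟨e₁, he₁, hch⟩
    refine ⟨⟨e₁, he₁⟩, ?_⟩
    -- an `AccStep` chain from the tube edge stays in its class
    show e ∈ 𝒵.accCls X ω e₁
    induction hch with
    | refl => exact mem_accCls_self (acc_of_mem_tubeEdges he₁)
    | tail _ hst ih =>
      obtain ⟨hcf, v, hvb, hvc, hvO⟩ := hst
      exact mem_accCls_step (acc_of_mem_tubeEdges he₁) ih hcf hvb hvc hvO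

/-- The accessible set of a member of the family is a class. [folklore] -/
@[simp] theorem tileFamily_acc (hT : IsTerminal 𝒵.seeds X ω) (hN : 𝒵.Nice') (i : {e // e ∈ 𝒵.tubeEdges}) :
    ((𝒵.tileFamily hT hN).𝒯 i).acc = 𝒵.accCls X ω i.1 := rfl

end Zones

end Seeded

end Literature.Probability.Percolation

end
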